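import Literature.Geometry.ComplexHyperbolic.UnitBallRegularOrbitDRegimeBound     -- ★ p844060 (this seat): support volume `μ(S_ρ) = Cρ²`, D-regime orbital bound; brings ★ p844013, ★ (β-0), ★ `UnitBallBounds`
import HarnessLib

/-!
# Crude DERIVATIVE bounds for the regular orbital integral of `U(2,1)` in the D regime: `Φ_Θ` is differentiable along every torus line with `‖∂_v Φ_Θ‖ ≤ 9·B₁·‖v‖·(1+ρ)·C_μ·ρ²`, `ρ = √2R∕m`
# (ROAD A, design «(A6) IN-HOUSE» v1 §2.1 brick (c2), order `k = 1` — the pattern file; Folland 1995 Thm. 2.27; Rogawski 1990 §8.4)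

Topic `Geometry/ComplexHyperbolic`; namespace `Literature.Geometry.ComplexHyperbolic.BallModel`.  THEOREMS ONLY (no `def`, no instance, no notation, no axiom, no named fact, no `sorry`).
Cell `pub/hodgecm-mathlib`, ENGINE T1 (crux H413 = `stmt-HodgeConjecture-24833`); ROAD A (N1 = `stub_L21`), design `DESIGN-A6-InHouse` 084f8d14 §2.1 (III-c) (c2): the polynomial derivative bounds that
make `Λ₈F_Θ` Lipschitz on compact-wall horns; author F0P3a-p05 (g14) (ROAD A owner), 2026-09-01.  Order 1 along a torus line `θ + s•v`; higher orders iterate the same domination (the integrand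
class `X ↦ DʲΘ(X)[g·D₁·g⁻¹, …]` has the same corner support and costs one factor `9|g₂₂|²‖v‖ ≤ 9(1+ρ)‖v‖` per derivative).

THE MATHEMATICS (`G = U(2,1)`, `μ` Haar with support-volume constant `C` (★ `exists_measure_real_setOf_norm_22_sq_le_eq`), `X(g,θ′) = mat g · diag(ζe^{iθ′}) · mat g⁻¹`).
* §1 OPERATOR-NORM BOOKKEEPING (`‖·‖` = Mathlib's `L^∞`-operator norm on `M₃(ℂ)`, `open scoped Matrix.Norms.Operator`): `|X_{ij}| ≤ ‖X‖`; `‖mat g‖, ‖mat g⁻¹‖ ≤ 3|g₂₂|` (every entry is `≤ |g₂₂|`,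
  ★ `norm_entry_le_norm_22`, ★ `norm_mat_inv_apply`); hence **`‖mat g · D · mat g⁻¹‖ ≤ 9|g₂₂|²·‖D‖`**; a compactly supported `Θ` has a corner radius `R` with `R ≤ |X₂₂ − u| ⇒ X ∉ tsupport Θ` for all `|u| ≤ 1`
  (so `Θ` AND `DΘ` vanish there).
* §2 THE TORUS LINE: `s ↦ X(g, θ + s•v)` has derivative `Y(g,θ′,v) = mat g · diag(ζe^{iθ′_p}·i v_p) · mat g⁻¹` (`θ′ = θ + s•v`), `‖diag(ζe^{iθ′_p} i v_p)‖ ≤ ‖v‖`; and `X(g,θ′)` IS the cell's token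
  `mat(g · mkU21(diag(ζe^{iθ′})) · g⁻¹)`.
* §3 **DIFFERENTIATION UNDER `∫_G` WITH AN EXPLICIT BOUND**: if on the parameter ball `|s| < s₀` the D regime holds with `min(|z₂−z₀|,|z₂−z₁|) ≥ m > 0` (hypotheses `hDs`, `hms` — the consumer gets them
  from openness), `Θ ∈ C¹` with `‖DΘ‖ ≤ B₁` and corner radius `R`, then the integrand family is dominated by `9B₁‖v‖(1+ρ)·1_{S_ρ}`, `ρ = √2R∕m` (★ support bound p844013: the integrand and its
  `s`-derivative vanish off the compact `S_ρ`), so (Mathlib `hasDerivAt_integral_of_dominated_loc_of_deriv_le`)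
  **`HasDerivAt (s ↦ Φ_Θ(θ + s•v)) (∫_G DΘ(X(g,θ))[Y(g,θ,v)] dμ) 0`** and **`‖∫_G DΘ(X(g,θ))[Y(g,θ,v)] dμ‖ ≤ 9·B₁·‖v‖·(1+ρ)·(C·ρ²)`** — polynomial in `R∕m`, degree `2 + 2·1`.
HONEST LABEL: HC_CM is proved only modulo the printed citations until rung 0 closes; an elementary estimate for a road ((III) «horn letter») that is PRICED, NOT STAFFED (LEAD T9-30 (5)); pays nothing by itself.

## References
* [Folland1995] G. B. Folland, *A Course in Abstract Harmonic Analysis* (1995), Thm. 2.27 (differentiation under the integral sign).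
* [Rogawski1990] J. D. Rogawski, *Automorphic Representations of Unitary Groups in Three Variables*, Ann. of Math. Stud. 123 (1990), §8.4 pp. 126–127.
* [Rudin1980] W. Rudin, *Function Theory in the Unit Ball of ℂⁿ* (1980), §1.4.
-/

set_option autoImplicit false

noncomputable section

open Matrix Complex ComplexConjugate MeasureTheory Measure MulAction Topology Set Function Filter Metric
open scoped ENNReal NNReal Matrix.Norms.Operator

namespace Literature.Geometry.ComplexHyperbolic

namespace BallModel

/-! ## §1 Operator-norm bookkeeping on `U(2,1)` -/

section OpNorm

/-- An entry is bounded by the `L^∞`-operator norm: `|X_{ij}| ≤ ‖X‖`. [cite: Rudin1980, §1.4] -/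
theorem norm_apply_le_linfty_opNorm (X : Matrix (Fin 3) (Fin 3) ℂ) (i j : Fin 3) : ‖X i j‖ ≤ ‖X‖ := by
  have h : ‖X i j‖₊ ≤ ‖X‖₊ := by
    rw [Matrix.linfty_opNNNorm_def]
    exact le_trans (Finset.single_le_sum (f := fun j => ‖X i j‖₊) (fun _ _ => bot_le) (Finset.mem_univ j)) (Finset.le_sup (f := fun i => ∑ j, ‖X i j‖₊) (Finset.mem_univ i))
  exact_mod_cast h

/-- A matrix with all entries `≤ c` has `‖X‖ ≤ 3c`. [cite: Rudin1980, §1.4] -/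
theorem linfty_opNorm_le_three_mul (X : Matrix (Fin 3) (Fin 3) ℂ) {c : ℝ} (h : ∀ i j, ‖X i j‖ ≤ c) : ‖X‖ ≤ 3 * c := by
  have hc : 0 ≤ c := le_trans (norm_nonneg _) (h 0 0)
  rw [Matrix.linfty_opNorm_def]
  have hrow : ∀ i : Fin 3, ((∑ j : Fin 3, ‖X i j‖₊ : ℝ≥0) : ℝ) ≤ 3 * c := by
    intro i
    push_cast
    calc ∑ j : Fin 3, ‖X i j‖ ≤ ∑ _j : Fin 3, c := Finset.sum_le_sum fun j _ => h i j
      _ = 3 * c := by simp [Finset.sum_const, Finset.card_univ, Fintype.card_fin]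
  have hc3 : (0 : ℝ) ≤ 3 * c := by positivity
  have : (Finset.univ.sup fun i : Fin 3 => ∑ j : Fin 3, ‖X i j‖₊) ≤ (⟨3 * c, hc3⟩ : ℝ≥0) := Finset.sup_le fun i _ => by
    rw [← NNReal.coe_le_coe]; exact hrow i
  exact_mod_cast this

/-- **`‖mat g‖ ≤ 3·|g₂₂|`** (every entry of an element of `U(2,1)` is dominated by the corner entry, ★ `norm_entry_le_norm_22`). [cite: Rudin1980, §1.4] -/
theorem linfty_opNorm_mat_le (g : U21) : ‖mat g‖ ≤ 3 * ‖mat g 2 2‖ :=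
  linfty_opNorm_le_three_mul _ fun i j => norm_entry_le_norm_22 g i j

/-- **`‖mat g⁻¹‖ ≤ 3·|g₂₂|`** (`|(g⁻¹)_{ij}| = |g_{ji}|`, ★ `norm_mat_inv_apply`). [cite: Rudin1980, §1.4] -/
theorem linfty_opNorm_mat_inv_le (g : U21) : ‖mat g⁻¹‖ ≤ 3 * ‖mat g 2 2‖ :=
  linfty_opNorm_le_three_mul _ fun i j => by rw [norm_mat_inv_apply]; exact norm_entry_le_norm_22 g j i

/-- **`‖mat g · D · mat g⁻¹‖ ≤ 9·|g₂₂|²·‖D‖`** — the cost of one torus derivative after conjugation. [cite: Rudin1980, §1.4] -/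
theorem linfty_opNorm_conj_le (g : U21) (D : Matrix (Fin 3) (Fin 3) ℂ) : ‖mat g * D * mat g⁻¹‖ ≤ 9 * ‖mat g 2 2‖ ^ 2 * ‖D‖ := by
  have h1 := linfty_opNorm_mat_le g
  have h2 := linfty_opNorm_mat_inv_le g
  have h0 : 0 ≤ ‖mat g 2 2‖ := norm_nonneg _
  calc ‖mat g * D * mat g⁻¹‖ ≤ ‖mat g * D‖ * ‖mat g⁻¹‖ := norm_mul_le _ _
    _ ≤ (‖mat g‖ * ‖D‖) * ‖mat g⁻¹‖ := mul_le_mul_of_nonneg_right (norm_mul_le _ _) (norm_nonneg _)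
    _ ≤ (3 * ‖mat g 2 2‖ * ‖D‖) * (3 * ‖mat g 2 2‖) :=
        mul_le_mul (mul_le_mul_of_nonneg_right h1 (norm_nonneg _)) h2 (norm_nonneg _) (by positivity)
    _ = 9 * ‖mat g 2 2‖ ^ 2 * ‖D‖ := by ring

/-- **UNIFORM CORNER RADIUS, `tsupport` form**: a compactly supported `Θ` has `R > 0` with `R ≤ |X₂₂ − u| ⇒ X ∉ tsupport Θ` for every `|u| ≤ 1` — so `Θ(X) = 0` AND `DΘ(X) = 0` there.
[cite: Rudin1980, §1.4] -/
theorem exists_radius_not_mem_tsupport {G : Type*} [Zero G] [TopologicalSpace G] (Θ : Matrix (Fin 3) (Fin 3) ℂ → G) (hΘc : HasCompactSupport Θ) :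
    ∃ R : ℝ, 0 < R ∧ ∀ u : ℂ, ‖u‖ ≤ 1 → ∀ X : Matrix (Fin 3) (Fin 3) ℂ, R ≤ ‖X 2 2 - u‖ → X ∉ tsupport Θ := by
  obtain ⟨M, hM⟩ := hΘc.isCompact.isBounded.exists_norm_le
  refine ⟨max M 0 + 2, by positivity, fun u hu X hX hmem => ?_⟩
  have h1 : ‖X‖ ≤ M := hM X hmem
  have h2 : ‖X 2 2‖ ≤ ‖X‖ := norm_apply_le_linfty_opNorm X 2 2
  have h3 : ‖X 2 2 - u‖ ≤ ‖X 2 2‖ + ‖u‖ := norm_sub_le _ _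
  linarith [le_max_left M 0]

end OpNorm

/-! ## §2 The torus line through the spectral form -/

section Line

/-- `‖N(c_p(g))‖ ≤ 3·|g₂₂|²` for the column projectors `N(c_p) = c_p c_p^* J` (entries `|g_{ip} ḡ_{jp} J_{jj}| ≤ |g₂₂|²`). [cite: Rudin1980, §1.4] -/
theorem linfty_opNorm_vecMulVec_matCol_le (g : U21) (p : Fin 3) :
    ‖vecMulVec (fun j => mat g j p) (star fun j => mat g j p) * J‖ ≤ 3 * ‖mat g 2 2‖ ^ 2 := by
  refine linfty_opNorm_le_three_mul _ fun i j => ?_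
  rw [vecMulVec_star_mul_J_apply, norm_mul, norm_mul, norm_J_apply_self, mul_one, Complex.norm_conj, sq]
  exact mul_le_mul (norm_entry_le_norm_22 g i p) (norm_entry_le_norm_22 g j p) (norm_nonneg _) (norm_nonneg _)

/-- The scalar coefficient `s ↦ ζ·e^{i(θ_p + s v_p)}·J_{pp}` and its derivative `ζ·e^{i(θ_p + s v_p)}·(i v_p)·J_{pp}`. [cite: Rogawski1990, §8.4 p. 126] -/
theorem hasDerivAt_circleExp_coeff (ζ : Circle) (θ v : Fin 3 → ℝ) (p : Fin 3) (s : ℝ) :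
    HasDerivAt (fun s : ℝ => (((ζ * Circle.exp ((θ + s • v) p) : Circle) : ℂ)) * J p p)
      ((((ζ * Circle.exp ((θ + s • v) p) : Circle) : ℂ)) * (Complex.I * v p) * J p p) s := by
  have hlin : HasDerivAt (fun s : ℝ => (((θ + s • v) p : ℝ) : ℂ) * Complex.I) ((v p : ℂ) * Complex.I) s := by
    have h1 : HasDerivAt (fun s : ℝ => ((θ p + s * v p : ℝ) : ℂ)) ((v p : ℂ)) s := by
      have := ((hasDerivAt_id s).mul_const (v p)).const_add (θ p)
      simpa using this.ofReal_comp
    simpa [Pi.add_apply, Pi.smul_apply, smul_eq_mul] using h1.mul_const Complex.I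
  have hexp := ((Complex.hasDerivAt_exp _).comp s hlin).const_mul (ζ : ℂ)
  have hfun : (fun s : ℝ => (((ζ * Circle.exp ((θ + s • v) p) : Circle) : ℂ)) * J p p) = fun s : ℝ => ((ζ : ℂ) * Complex.exp ((((θ + s • v) p : ℝ) : ℂ) * Complex.I)) * J p p := by
    funext s; rw [Circle.coe_mul, Circle.coe_exp]
  rw [hfun]
  refine (hexp.mul_const (J p p)).congr_deriv ?_
  have hc : (((ζ * Circle.exp ((θ + s • v) p) : Circle) : ℂ)) = (ζ : ℂ) * Complex.exp ((((θ + s • v) p : ℝ) : ℂ) * Complex.I) := by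
    rw [Circle.coe_mul, Circle.coe_exp]
  rw [hc]
  ring

/-- `|ζ·e^{iθ′_p}·(i v_p)·J_{pp}| = |v_p| ≤ ‖v‖`. [cite: Rudin1980, §1.4] -/
theorem norm_circleExp_coeff_deriv_le (ζ : Circle) (θ' v : Fin 3 → ℝ) (p : Fin 3) :
    ‖(((ζ * Circle.exp (θ' p) : Circle) : ℂ)) * (Complex.I * v p) * J p p‖ ≤ ‖v‖ := by
  rw [norm_mul, norm_mul, Circle.norm_coe, one_mul, norm_J_apply_self, mul_one, norm_mul, Complex.norm_I, one_mul, Complex.norm_real]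
  exact norm_le_pi_norm v p

end Line

/-! ## §3 Differentiation under the integral in the D regime, with the explicit bound -/

section Deriv

variable {E : Type*} [NormedAddCommGroup E] [NormedSpace ℝ E]

/-- **(c2), ORDER 1: `Φ_Θ` IS DIFFERENTIABLE ALONG TORUS LINES IN THE D REGIME, WITH A POLYNOMIAL BOUND.**  Data: a measure `μ` finite on compacts with support-volume bound `μ.real S_ρ ≤ C·ρ²`
(Haar: ★ `exists_measure_real_setOf_norm_22_sq_le_eq`); `Θ ∈ C¹(M₃(ℂ), E)` with `‖DΘ(X)[Y]‖ ≤ B₁‖Y‖` and corner radius `R` in `tsupport` form (★ `exists_radius_not_mem_tsupport`); base angle `θ`,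
direction `v`, `ζ ∈ S¹`, and a parameter ball `|s| < s₀` on which the D regime holds with `min(|z₂−z₀|,|z₂−z₁|) ≥ m > 0` (`z(s) = ζe^{i(θ+sv)}`).  THEN with `ρ = √2R∕m`, `t(s) = diag z(s)`, and the
spectral derivative `Y(g,v) = Σ_{p=0,1,2} ζe^{iθ_p}(i v_p)J_{pp}·N(c_p(g))` (written as a three-term sum):  `HasDerivAt (s ↦ ∫_G Θ(mat(g·t(s)·g⁻¹)) dμ) (∫_G DΘ(mat(g·t(0)·g⁻¹))[Y(g,v)] dμ) 0` and
`‖∫_G DΘ(mat(g·t(0)·g⁻¹))[Y(g,v)] dμ‖ ≤ 9·B₁·‖v‖·(1+ρ)·(C·ρ²)` (Mathlib `hasDerivAt_integral_of_dominated_loc_of_deriv_le`; the dominator is `9B₁‖v‖(1+ρ)·1_{S_ρ}`, ★ p844013).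
[cite: Folland1995, Thm. 2.27] [cite: Rogawski1990, §8.4 pp. 126–127] -/
theorem hasDerivAt_integral_comp_conj_line_of_D (μ : Measure U21) [IsFiniteMeasureOnCompacts μ] {C : ℝ}
    (hC : ∀ ρ : ℝ, 0 ≤ ρ → μ.real {g : U21 | ‖mat g 2 2‖ ^ 2 ≤ 1 + ρ} ≤ C * ρ ^ 2)
    (Θ : Matrix (Fin 3) (Fin 3) ℂ → E) (hΘ : ContDiff ℝ 1 Θ) {B₁ : ℝ} (hB₁0 : 0 ≤ B₁) (hB₁ : ∀ X Y, ‖fderiv ℝ Θ X Y‖ ≤ B₁ * ‖Y‖)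
    (ζ : Circle) (θ v : Fin 3 → ℝ) {m R s₀ : ℝ} (hm : 0 < m) (hR0 : 0 ≤ R) (hs₀ : 0 < s₀)
    (hR : ∀ u : ℂ, ‖u‖ ≤ 1 → ∀ X : Matrix (Fin 3) (Fin 3) ℂ, R ≤ ‖X 2 2 - u‖ → X ∉ tsupport Θ)
    (hDs : ∀ s ∈ ball (0 : ℝ) s₀, 0 ≤ (((((ζ * Circle.exp ((θ + s • v) 2) : Circle) : ℂ)) - ((ζ * Circle.exp ((θ + s • v) 0) : Circle) : ℂ)) *
      conj ((((ζ * Circle.exp ((θ + s • v) 2) : Circle) : ℂ)) - ((ζ * Circle.exp ((θ + s • v) 1) : Circle) : ℂ))).re)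
    (hms : ∀ s ∈ ball (0 : ℝ) s₀, m ≤ min ‖(((ζ * Circle.exp ((θ + s • v) 2) : Circle) : ℂ)) - ((ζ * Circle.exp ((θ + s • v) 0) : Circle) : ℂ)‖
      ‖(((ζ * Circle.exp ((θ + s • v) 2) : Circle) : ℂ)) - ((ζ * Circle.exp ((θ + s • v) 1) : Circle) : ℂ)‖) :
    HasDerivAt (fun s : ℝ => ∫ g, Θ (mat (g * mkU21 (Matrix.diagonal fun i => (((fun k : Fin 3 => ζ * Circle.exp ((θ + s • v) k)) i : Circle) : ℂ)) (diagonal_circle_preserves _) * g⁻¹)) ∂μ)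
      (∫ g, fderiv ℝ Θ (mat (g * mkU21 (Matrix.diagonal fun i => (((fun k : Fin 3 => ζ * Circle.exp (θ k)) i : Circle) : ℂ)) (diagonal_circle_preserves _) * g⁻¹))
        (((((ζ * Circle.exp (θ 0) : Circle) : ℂ)) * (Complex.I * v 0) * J 0 0) • (vecMulVec (fun j => mat g j 0) (star fun j => mat g j 0) * J)
          + ((((ζ * Circle.exp (θ 1) : Circle) : ℂ)) * (Complex.I * v 1) * J 1 1) • (vecMulVec (fun j => mat g j 1) (star fun j => mat g j 1) * J)
          + ((((ζ * Circle.exp (θ 2) : Circle) : ℂ)) * (Complex.I * v 2) * J 2 2) • (vecMulVec (fun j => mat g j 2) (star fun j => mat g j 2) * J)) ∂μ) 0 ∧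
    ‖∫ g, fderiv ℝ Θ (mat (g * mkU21 (Matrix.diagonal fun i => (((fun k : Fin 3 => ζ * Circle.exp (θ k)) i : Circle) : ℂ)) (diagonal_circle_preserves _) * g⁻¹))
        (((((ζ * Circle.exp (θ 0) : Circle) : ℂ)) * (Complex.I * v 0) * J 0 0) • (vecMulVec (fun j => mat g j 0) (star fun j => mat g j 0) * J)
          + ((((ζ * Circle.exp (θ 1) : Circle) : ℂ)) * (Complex.I * v 1) * J 1 1) • (vecMulVec (fun j => mat g j 1) (star fun j => mat g j 1) * J)
          + ((((ζ * Circle.exp (θ 2) : Circle) : ℂ)) * (Complex.I * v 2) * J 2 2) • (vecMulVec (fun j => mat g j 2) (star fun j => mat g j 2) * J)) ∂μ‖ ≤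
      9 * B₁ * ‖v‖ * (1 + Real.sqrt 2 * R / m) * (C * (Real.sqrt 2 * R / m) ^ 2) := by
  -- abbreviations
  set ρ : ℝ := Real.sqrt 2 * R / m with hρ
  have hρ0 : 0 ≤ ρ := by positivity
  set S : Set U21 := {g : U21 | ‖mat g 2 2‖ ^ 2 ≤ 1 + ρ} with hSdef
  have hSc : IsCompact S := isCompact_setOf_norm_22_sq_le hρ0
  have hSm : MeasurableSet S := measurableSet_setOf_norm_22_sq_le ρ
  set X : U21 → ℝ → Matrix (Fin 3) (Fin 3) ℂ := fun g s =>
    mat (g * mkU21 (Matrix.diagonal fun i => (((fun k : Fin 3 => ζ * Circle.exp ((θ + s • v) k)) i : Circle) : ℂ)) (diagonal_circle_preserves _) * g⁻¹) with hXdef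
  set Y : U21 → ℝ → Matrix (Fin 3) (Fin 3) ℂ := fun g s =>
    ((((ζ * Circle.exp ((θ + s • v) 0) : Circle) : ℂ)) * (Complex.I * v 0) * J 0 0) • (vecMulVec (fun j => mat g j 0) (star fun j => mat g j 0) * J)
      + ((((ζ * Circle.exp ((θ + s • v) 1) : Circle) : ℂ)) * (Complex.I * v 1) * J 1 1) • (vecMulVec (fun j => mat g j 1) (star fun j => mat g j 1) * J)
      + ((((ζ * Circle.exp ((θ + s • v) 2) : Circle) : ℂ)) * (Complex.I * v 2) * J 2 2) • (vecMulVec (fun j => mat g j 2) (star fun j => mat g j 2) * J) with hYdef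
  have hzero : θ + (0 : ℝ) • v = θ := by simp
  -- spectral form of `X g s`
  have hXsum : ∀ g s, X g s = ∑ p : Fin 3, ((((ζ * Circle.exp ((θ + s • v) p) : Circle) : ℂ)) * J p p) • (vecMulVec (fun j => mat g j p) (star fun j => mat g j p) * J) :=
    fun g s => mat_conj_diagonal_eq_sum g _ _
  -- off `S`, `X g s ∉ tsupport Θ` for `|s| < s₀`
  have hoff : ∀ s ∈ ball (0 : ℝ) s₀, ∀ g ∉ S, X g s ∉ tsupport Θ := by
    intro s hs g hg
    apply hR (((ζ * Circle.exp ((θ + s • v) 2) : Circle) : ℂ)) (by rw [Circle.norm_coe])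
    by_contra hlt
    push Not at hlt
    exact hg (norm_22_sq_le_of_corner_le g (fun k : Fin 3 => ζ * Circle.exp ((θ + s • v) k)) (diagonal_circle_preserves _) (hDs s hs) hm (hms s hs) hlt.le)
  -- continuity in `g`
  have hXc : ∀ s, Continuous fun g : U21 => X g s := fun s => continuous_mat_conj _
  have hYc : ∀ s, Continuous fun g : U21 => Y g s := fun s =>
    (((continuous_const_smul _).comp (continuous_vecMulVec_matCol 0)).add ((continuous_const_smul _).comp (continuous_vecMulVec_matCol 1))).add
      ((continuous_const_smul _).comp (continuous_vecMulVec_matCol 2))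
  have hDΘc : Continuous (fderiv ℝ Θ) := hΘ.continuous_fderiv one_ne_zero
  have hFc : ∀ s, Continuous fun g : U21 => Θ (X g s) := fun s => hΘ.continuous.comp (hXc s)
  have hF'c : ∀ s, Continuous fun g : U21 => fderiv ℝ Θ (X g s) (Y g s) := fun s =>
    isBoundedBilinearMap_apply.continuous.comp ((hDΘc.comp (hXc s)).prodMk (hYc s))
  -- derivative of `s ↦ X g s`, composed with `Θ`
  have hdiff : ∀ g s, HasDerivAt (fun s => Θ (X g s)) (fderiv ℝ Θ (X g s) (Y g s)) s := by
    intro g s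
    have h0 := (hasDerivAt_circleExp_coeff ζ θ v 0 s).smul_const (vecMulVec (fun j => mat g j 0) (star fun j => mat g j 0) * J)
    have h1 := (hasDerivAt_circleExp_coeff ζ θ v 1 s).smul_const (vecMulVec (fun j => mat g j 1) (star fun j => mat g j 1) * J)
    have h2 := (hasDerivAt_circleExp_coeff ζ θ v 2 s).smul_const (vecMulVec (fun j => mat g j 2) (star fun j => mat g j 2) * J)
    have hX' := (h0.add h1).add h2
    exact ((hΘ.differentiable one_ne_zero) (X g s)).hasFDerivAt.comp_hasDerivAt s
      (hX'.congr_of_eventuallyEq (Eventually.of_forall fun s' => by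
        show X g s' = _
        rw [hXsum, Fin.sum_univ_three]
        rfl))
  -- bound on `‖Y g s‖`
  have hYn : ∀ g s, ‖Y g s‖ ≤ 9 * ‖mat g 2 2‖ ^ 2 * ‖v‖ := by
    intro g s
    have hterm : ∀ p : Fin 3, ‖((((ζ * Circle.exp ((θ + s • v) p) : Circle) : ℂ)) * (Complex.I * v p) * J p p) • (vecMulVec (fun j => mat g j p) (star fun j => mat g j p) * J)‖ ≤
        ‖v‖ * (3 * ‖mat g 2 2‖ ^ 2) := fun p =>
      le_trans (norm_smul_le _ _) (mul_le_mul (norm_circleExp_coeff_deriv_le ζ (θ + s • v) v p) (linfty_opNorm_vecMulVec_matCol_le g p) (norm_nonneg _) (norm_nonneg _))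
    calc ‖Y g s‖ ≤ ‖((((ζ * Circle.exp ((θ + s • v) 0) : Circle) : ℂ)) * (Complex.I * v 0) * J 0 0) • (vecMulVec (fun j => mat g j 0) (star fun j => mat g j 0) * J)
              + ((((ζ * Circle.exp ((θ + s • v) 1) : Circle) : ℂ)) * (Complex.I * v 1) * J 1 1) • (vecMulVec (fun j => mat g j 1) (star fun j => mat g j 1) * J)‖
            + ‖((((ζ * Circle.exp ((θ + s • v) 2) : Circle) : ℂ)) * (Complex.I * v 2) * J 2 2) • (vecMulVec (fun j => mat g j 2) (star fun j => mat g j 2) * J)‖ := norm_add_le _ _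
      _ ≤ (‖v‖ * (3 * ‖mat g 2 2‖ ^ 2) + ‖v‖ * (3 * ‖mat g 2 2‖ ^ 2)) + ‖v‖ * (3 * ‖mat g 2 2‖ ^ 2) :=
          add_le_add (le_trans (norm_add_le _ _) (add_le_add (hterm 0) (hterm 1))) (hterm 2)
      _ = 9 * ‖mat g 2 2‖ ^ 2 * ‖v‖ := by ring
  -- the dominating function and the pointwise bound
  set bound : U21 → ℝ := S.indicator (fun _ => 9 * B₁ * ‖v‖ * (1 + ρ)) with hbound
  have hbound_int : Integrable bound μ := (integrable_indicator_iff hSm).2 (integrableOn_const hSc.measure_lt_top.ne)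
  have hF'le : ∀ s ∈ ball (0 : ℝ) s₀, ∀ g, ‖fderiv ℝ Θ (X g s) (Y g s)‖ ≤ bound g := by
    intro s hs g
    by_cases hg : g ∈ S
    · rw [hbound, indicator_of_mem hg]
      have hg' : ‖mat g 2 2‖ ^ 2 ≤ 1 + ρ := hg
      calc ‖fderiv ℝ Θ (X g s) (Y g s)‖ ≤ B₁ * ‖Y g s‖ := hB₁ _ _
        _ ≤ B₁ * (9 * ‖mat g 2 2‖ ^ 2 * ‖v‖) := mul_le_mul_of_nonneg_left (hYn g s) hB₁0
        _ ≤ B₁ * (9 * (1 + ρ) * ‖v‖) := mul_le_mul_of_nonneg_left (by nlinarith [norm_nonneg v, hg']) hB₁0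
        _ = 9 * B₁ * ‖v‖ * (1 + ρ) := by ring
    · have h0 : fderiv ℝ Θ (X g s) = 0 := fderiv_of_notMem_tsupport ℝ (hoff s hs g hg)
      have h0' : fderiv ℝ Θ (X g s) (Y g s) = 0 := by rw [h0]; rfl
      rw [h0', norm_zero, hbound]
      exact indicator_nonneg (fun _ _ => by positivity) g
  -- integrability at `s = 0`
  have h0mem : (0 : ℝ) ∈ ball (0 : ℝ) s₀ := mem_ball_self hs₀
  have hF0_int : Integrable (fun g : U21 => Θ (X g 0)) μ := by
    refine (hFc 0).integrable_of_hasCompactSupport (HasCompactSupport.of_support_subset_isCompact hSc fun g hg => ?_)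
    by_contra hgS
    exact hg (image_eq_zero_of_notMem_tsupport (hoff 0 h0mem g hgS))
  -- differentiation under the integral sign
  have hmain := hasDerivAt_integral_of_dominated_loc_of_deriv_le (μ := μ) (F := fun s g => Θ (X g s)) (F' := fun s g => fderiv ℝ Θ (X g s) (Y g s))
    (x₀ := (0 : ℝ)) (bound := bound) (ball_mem_nhds (0 : ℝ) hs₀)
    (Eventually.of_forall fun s => (hFc s).aestronglyMeasurable) hF0_int (hF'c 0).aestronglyMeasurable
    (Eventually.of_forall fun g s hs => hF'le s hs g) hbound_int (Eventually.of_forall fun g s _ => hdiff g s)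
  have hX0 : ∀ g, X g 0 = mat (g * mkU21 (Matrix.diagonal fun i => (((fun k : Fin 3 => ζ * Circle.exp (θ k)) i : Circle) : ℂ)) (diagonal_circle_preserves _) * g⁻¹) := by
    intro g; simp only [hXdef, hzero]
  have hY0 : ∀ g, Y g 0 = ((((ζ * Circle.exp (θ 0) : Circle) : ℂ)) * (Complex.I * v 0) * J 0 0) • (vecMulVec (fun j => mat g j 0) (star fun j => mat g j 0) * J)
          + ((((ζ * Circle.exp (θ 1) : Circle) : ℂ)) * (Complex.I * v 1) * J 1 1) • (vecMulVec (fun j => mat g j 1) (star fun j => mat g j 1) * J)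
          + ((((ζ * Circle.exp (θ 2) : Circle) : ℂ)) * (Complex.I * v 2) * J 2 2) • (vecMulVec (fun j => mat g j 2) (star fun j => mat g j 2) * J) := by
    intro g; simp only [hYdef, hzero]
  refine ⟨?_, ?_⟩
  · have h := hmain.2
    simp only [hX0, hY0] at h
    exact h
  · have h1 : ‖∫ g, fderiv ℝ Θ (X g 0) (Y g 0) ∂μ‖ ≤ ∫ g, bound g ∂μ :=
      norm_integral_le_of_norm_le hbound_int (Eventually.of_forall fun g => hF'le 0 h0mem g)
    have h2 : ∫ g, bound g ∂μ = μ.real S * (9 * B₁ * ‖v‖ * (1 + ρ)) := by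
      rw [hbound, integral_indicator_const _ hSm, smul_eq_mul]
    have h3 : μ.real S * (9 * B₁ * ‖v‖ * (1 + ρ)) ≤ (C * ρ ^ 2) * (9 * B₁ * ‖v‖ * (1 + ρ)) :=
      mul_le_mul_of_nonneg_right (hC ρ hρ0) (by positivity)
    simp only [hX0, hY0] at h1
    calc _ ≤ ∫ g, bound g ∂μ := h1
      _ ≤ (C * ρ ^ 2) * (9 * B₁ * ‖v‖ * (1 + ρ)) := by rw [h2]; exact h3
      _ = 9 * B₁ * ‖v‖ * (1 + ρ) * (C * ρ ^ 2) := by ring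

end Deriv

end BallModel

end Literature.Geometry.ComplexHyperbolic

end
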